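import Mathlib
import Summits.Ventures.PercRepro2.K5StarGenSwap

/-!
# THE GENERAL-STAR CERTIFICATES, III: THE KRONECKER TREE INDEXED BY NUMBERS
(blind cell PercRepro2, mine-2 g41, 2026-08-29; `proofs/MINE2-GENSTAR.md` §4)

The tree `go3b8` of `K5StarGenB28Defs.lean` carries the configuration as a chain of `Function.update`s and
reads each leaf through it (ten lookups through a chain of depth ten, `≈ 2 · 10⁶` kernel steps per masked
table).  **`goI`** carries the base-2 INDEX of the configuration instead and reads the leaf with one
accelerated `Nat.testBit` of the index `ORed` with the mask — the same number (`goI_eq_go3b8`,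
`kronI_eq`: `kronI T (idx2 S) = kron38 T S`) at a twentieth of the cost.  `posOn38f` / `negOn38f` are the
swapped products through `kronI` on literal bit masks; `sumLI_map` carries the list sums across;
**`starNonnegGen_of_certI`** is the certificate theorem in this form (the one the certificate files use).

Own code; standard axioms.
-/

namespace Summit.Ventures.PercRepro2

open Hub

namespace K5

/-! ## The tree on indices -/

section Tree

/-- The Kronecker tree in base `KB8` on a bit table `B` through a bit mask `m`, indexed by numbers:
`goI B m n i` sums the leaves over the edges `< n`, the edges `≥ n` fixed by the base-2 index `i`;
the leaf reads the bit `i ||| m` of `B`. -/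
def goI (B m : ℕ) : ℕ → ℕ → ℕ
  | 0, i => (B.testBit (i ||| m)).toNat
  | n + 1, i => goI B m n i + KB8 ^ (4 ^ n) * goI B m n (i + 2 ^ n)

/-- The Kronecker number of the table `T` through the bit mask `m`, by the index tree. -/
def kronI (T : (Fin 10 → Bool) → Bool) (m : ℕ) : ℕ := goI (bits T) m 10 0

/-- Bit `e` of the index of a configuration is its state at `e`. -/
lemma testBit_idx2 (s : Fin 10 → Bool) (e : Fin 10) : (idx2 s).testBit (e : ℕ) = s e := by
  rw [Nat.testBit_eq_decide_div_mod_eq]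
  exact congrFun (decode2_idx2 s) e

/-- The index has no bits at or above `10`. -/
lemma testBit_idx2_of_ge (s : Fin 10 → Bool) {i : ℕ} (hi : 10 ≤ i) : (idx2 s).testBit i = false := by
  apply Nat.testBit_lt_two_pow
  calc idx2 s < 1024 := idx2_lt s
    _ = 2 ^ 10 := by norm_num
    _ ≤ 2 ^ i := Nat.pow_le_pow_right (by norm_num) hi

/-- The index of a masked configuration is the index ORed with the index of the mask. -/
lemma idx2_orOn (S ω : Fin 10 → Bool) : idx2 (orOn S ω) = idx2 ω ||| idx2 S := by
  apply Nat.eq_of_testBit_eq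
  intro i
  rw [Nat.testBit_lor]
  by_cases hi : i < 10
  · have h1 := testBit_idx2 (orOn S ω) ⟨i, hi⟩
    have h2 := testBit_idx2 ω ⟨i, hi⟩
    have h3 := testBit_idx2 S ⟨i, hi⟩
    simp only at h1 h2 h3
    rw [h1, h2, h3]
    rfl
  · rw [testBit_idx2_of_ge _ (by omega), testBit_idx2_of_ge _ (by omega), testBit_idx2_of_ge _ (by omega)]
    rfl

set_option maxRecDepth 100000 in
/-- Opening a closed edge adds its weight to the index. -/
lemma idx2_update_true : ∀ (ω : Fin 10 → Bool) (n : Fin 10), ω n = false →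
    idx2 (Function.update ω n true) = idx2 ω + 2 ^ (n : ℕ) := by
  decide +kernel

/-- The value of `Fin.ofNat 10 n` for `n < 10`. -/
lemma val_ofNat_ten {n : ℕ} (hn : n < 10) : ((Fin.ofNat 10 n : Fin 10) : ℕ) = n := by
  simp [Fin.ofNat, Nat.mod_eq_of_lt hn]

/-- **The index tree is the configuration tree**: with the edges below `n` closed, `goI` at the index of
`ω` is `go3b8` at `ω`. -/
lemma goI_eq_go3b8 (B : ℕ) (S : Fin 10 → Bool) :
    ∀ (n : ℕ), n ≤ 10 → ∀ (ω : Fin 10 → Bool), (∀ e : Fin 10, (e : ℕ) < n → ω e = false) →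
      goI B (idx2 S) n (idx2 ω) = go3b8 B S n ω
  | 0, _, ω, _ => by
    simp only [goI, go3b8, idx2_orOn]
  | n + 1, hn, ω, hω => by
    have hval : ((Fin.ofNat 10 n : Fin 10) : ℕ) = n := val_ofNat_ten (by omega)
    have hωn : ω (Fin.ofNat 10 n) = false := hω _ (by rw [hval]; omega)
    have h0 : Function.update ω (Fin.ofNat 10 n) false = ω := Function.update_eq_self_iff.2 hωn.symm
    rw [goI, go3b8, h0, goI_eq_go3b8 B S n (by omega) ω (fun e he => hω e (by omega))]
    congr 1
    congr 1
    have h1 : idx2 ω + 2 ^ n = idx2 (Function.update ω (Fin.ofNat 10 n) true) := by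
      rw [idx2_update_true ω _ hωn, hval]
    rw [h1]
    refine goI_eq_go3b8 B S n (by omega) _ fun e he => ?_
    rw [Function.update_apply]
    split_ifs with h
    · exfalso
      have := congrArg (fun x : Fin 10 => (x : ℕ)) h
      simp only [hval] at this
      omega
    · exact hω e (by omega)

/-- **`kronI` is `kron38`** at the index of the mask. -/
theorem kronI_eq (T : (Fin 10 → Bool) → Bool) (S : Fin 10 → Bool) : kronI T (idx2 S) = kron38 T S := by
  have h := goI_eq_go3b8 (bits T) S 10 le_rfl (fun _ => false) (fun _ _ => rfl)
  have h0 : idx2 (fun _ : Fin 10 => false) = 0 := rfl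
  rw [h0] at h
  exact h

end Tree

/-! ## The swapped products on literal bit masks -/

section Products

/-- The positive products of `K₃` in the swapped index on literal bit masks (through `prod3`). -/
def posOn38f (b : ℕ) (m₁ m₂ m₃ : ℕ) : ℕ :=
  prod3 (kronI (tsw tPD) m₁) (kronI (tsw tQ) m₂) (kronI (tsw (t4p b)) m₃) +
    prod3 (kronI (tsw tQ) m₁) (kronI (tsw tPDoU) m₂) (kronI (tsw (t5p b)) m₃) +
    prod3 (kronI (tsw tPD) m₁) (kronI (tsw tQ) m₂) (kronI (tsw (t6m b)) m₃) +
    prod3 (kronI (tsw tPD) m₁) (kronI (tsw (t7p b)) m₂) (kronI (tsw (t7m 0)) m₃) +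
    prod3 (kronI (tsw tPD) m₁) (kronI (tsw (t7m b)) m₂) (kronI (tsw (t7p 0)) m₃) +
    prod3 (kronI (tsw tPDoU) m₁) (kronI (tsw (t7p b)) m₂) (kronI (tsw (t7m 3)) m₃) +
    prod3 (kronI (tsw tPDoU) m₁) (kronI (tsw (t7m b)) m₂) (kronI (tsw (t7p 3)) m₃) +
    prod3 (kronI (tsw tPD) m₁) (kronI (tsw (t7p b)) m₂) (kronI (tsw t10p) m₃) +
    prod3 (kronI (tsw tPD) m₁) (kronI (tsw (t7m b)) m₂) (kronI (tsw t10m) m₃) +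
    prod3 (kronI (tsw tQ) m₁) (kronI (tsw (t12 b)) m₂) (kronI (tsw tPDoU) m₃)

/-- The negative products of `K₃` in the swapped index on literal bit masks (through `prod3`). -/
def negOn38f (b : ℕ) (m₁ m₂ m₃ : ℕ) : ℕ :=
  prod3 (kronI (tsw tPD) m₁) (kronI (tsw tQ) m₂) (kronI (tsw (t4m b)) m₃) +
    prod3 (kronI (tsw tQ) m₁) (kronI (tsw tPDoU) m₂) (kronI (tsw (t5m b)) m₃) +
    prod3 (kronI (tsw tPD) m₁) (kronI (tsw tQ) m₂) (kronI (tsw (t6p b)) m₃) +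
    prod3 (kronI (tsw tPD) m₁) (kronI (tsw (t7p b)) m₂) (kronI (tsw (t7p 0)) m₃) +
    prod3 (kronI (tsw tPD) m₁) (kronI (tsw (t7m b)) m₂) (kronI (tsw (t7m 0)) m₃) +
    prod3 (kronI (tsw tPDoU) m₁) (kronI (tsw (t7p b)) m₂) (kronI (tsw (t7p 3)) m₃) +
    prod3 (kronI (tsw tPDoU) m₁) (kronI (tsw (t7m b)) m₂) (kronI (tsw (t7m 3)) m₃) +
    prod3 (kronI (tsw tPD) m₁) (kronI (tsw (t7p b)) m₂) (kronI (tsw t10m) m₃) +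
    prod3 (kronI (tsw tPD) m₁) (kronI (tsw (t7m b)) m₂) (kronI (tsw t10p) m₃) +
    prod3 (kronI (tsw tPD) m₁) (kronI (tsw tQ) m₂) (kronI (tsw (t11 b)) m₃)

/-- `posOn38f` at the indices of the swapped masks is `posOn38sw`. -/
lemma posOn38f_eq (b : ℕ) (S₁ S₂ S₃ : Fin 10 → Bool) :
    posOn38f b (idx2 (swC S₁)) (idx2 (swC S₂)) (idx2 (swC S₃)) = posOn38sw b S₁ S₂ S₃ := by
  unfold posOn38f posOn38sw
  simp only [kronI_eq]

/-- `negOn38f` at the indices of the swapped masks is `negOn38sw`. -/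
lemma negOn38f_eq (b : ℕ) (S₁ S₂ S₃ : Fin 10 → Bool) :
    negOn38f b (idx2 (swC S₁)) (idx2 (swC S₂)) (idx2 (swC S₃)) = negOn38sw b S₁ S₂ S₃ := by
  unfold negOn38f negOn38sw
  simp only [kronI_eq]

/-- The sum of a function of bit-mask triples over a list. -/
def sumLI (f : ℕ → ℕ → ℕ → ℕ) : List (ℕ × ℕ × ℕ) → ℕ
  | [] => 0
  | t :: ms => f t.1 t.2.1 t.2.2 + sumLI f ms

/-- `sumLI` over an append. -/
lemma sumLI_append (f : ℕ → ℕ → ℕ → ℕ) : ∀ l₁ l₂ : List (ℕ × ℕ × ℕ),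
    sumLI f (l₁ ++ l₂) = sumLI f l₁ + sumLI f l₂
  | [], l₂ => by simp [sumLI]
  | t :: l₁, l₂ => by
    rw [List.cons_append, sumLI, sumLI, sumLI_append f l₁ l₂, add_assoc]

/-- The indices of the swapped masks of a mask triple. -/
def swIdx (t : Mask3) : ℕ × ℕ × ℕ := (idx2 (swC t.1), idx2 (swC t.2.1), idx2 (swC t.2.2))

/-- The list sums agree across `swIdx`. -/
lemma sumLI_map (b : ℕ) : ∀ ms : List Mask3,
    sumLI (negOn38f b) (ms.map swIdx) = sumL (negOn38sw b) ms ∧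
      sumLI (posOn38f b) (ms.map swIdx) = sumL (posOn38sw b) ms
  | [] => by simp [sumLI, sumL]
  | t :: ms => by
    obtain ⟨h1, h2⟩ := sumLI_map b ms
    simp only [List.map_cons, sumLI, sumL, swIdx, h1, h2, negOn38f_eq, posOn38f_eq, and_self]

variable {R : Type*} [Field R] [LinearOrder R] [IsStrictOrderedRing R]

/-- **`StarNonnegGen` from one certificate on the index tree**: the alive placements of `L` are the mask
list `ms`, their swapped indices the literal list `msI`, and `CertLE8` holds on the list sums of `msI`. -/
theorem starNonnegGen_of_certI (n : ℕ) (b : Fin 5) (hb : (b : ℕ) = n) (L : List (Fin 5 × ℕ))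
    (ms : List Mask3) (msI : List (ℕ × ℕ × ℕ)) (hms : ((placeList L ∅ ∅ ∅).map cmask3).filter alive = ms)
    (hmsI : ms.map swIdx = msI) (hlen : ms.length ≤ 454)
    (hc : CertLE8 (sumLI (negOn38f n) msI) (sumLI (posOn38f n) msI)) :
    StarNonnegGen R 0 1 2 3 b L := by
  refine starNonnegGen_of_certsw n b hb L ms hms hlen ?_
  obtain ⟨h1, h2⟩ := sumLI_map n ms
  rw [← h1, ← h2, hmsI]
  exact hc

end Products

end K5

end Summit.Ventures.PercRepro2
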